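import Summits.NavierStokesRegularity.FunctionalMining.StrainSqTransport
import Literature.Analysis.FunctionSpaces.TorusLowOrderLeibniz
import HarnessLib

/-!
# FunctionalMining — the weighted strain balance `d/dt ∫ Ψ(|S|²)` along classical solutions on `T^d`

Search for candidate a priori estimates; no regularity claim. Cell `pub-nsfunc`, prove seat
(gen 9). The dynamic identity behind the K0 rows `ES.absS.q|T_LD|G1` (strain moments
`∫|S|^q = ∫ (|S|²)^{q/2}`, SIEVELD §3.3). For a classical solution of
`∂ₜu + (u·∇)u = νΔu − ∇p + f`, `div u = 0` on `T^d × [a, b]` and a weight `Ψ` smooth on an open set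
containing the values of `|S|²`:

`d/dt ∫ Ψ(|S|²) = 2ν ∫ Ψ'(|S|²) ∑ᵢⱼ Sᵢⱼ (∂ᵢΔu)ⱼ − 2 ∫ Ψ'(|S|²) ∑ᵢⱼ Sᵢⱼ ∂ᵢ∂ⱼp`
`                 + 2 ∫ Ψ'(|S|²) ∑ᵢⱼ Sᵢⱼ (∂ᵢf)ⱼ − 2 ∫ Ψ'(|S|²) ∑ᵢⱼₖ Sᵢⱼ (∂ᵢu)ₖ (∂ₖu)ⱼ`

(one-sided, within `[a, b]`): differentiate under the integral, use `∂ₜ|S|²`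
(`GradientTensor.timeDerivWithin_strainSqAt`, Majda–Bertozzi (1.29) contracted with `2S`), and drop
the transport term `∫ Ψ'(|S|²)(u·∇)|S|² = ∫ (u·∇)(Ψ∘|S|²) = 0` (`div u = 0`). Unlike the vorticity
balance (tree `TorusWeightedVorticityBalance`), the pressure Hessian survives: it is symmetric and
pairs with the symmetric `S`. The viscous term is left as printed (not integrated by parts).

## Main statements

* `integral_deriv_comp_strainSqAt_mul_convect_eq_zero` — the transport term vanishes.
* `hasDerivWithinAt_integral_comp_strainSqAt` — the weighted strain balance.
-/

noncomputable section

open MeasureTheory Finset Set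
open scoped InnerProductSpace RealInnerProductSpace ContDiff

namespace Summit.NavierStokesRegularity.FunctionalMining

open Literature.Analysis.FunctionSpaces Literature.Analysis.FluidPDE

namespace GradientTensor

variable {d : Type*} [Fintype d] [DecidableEq d]

omit [DecidableEq d] in
/-- Smoothness of `g ∘ θ` for `g` smooth on a set containing the values of the smooth `θ`. [folklore] -/
private theorem isSmooth_comp {g : ℝ → ℝ} {U : Set ℝ} (hg : ContDiffOn ℝ ∞ g U)
    {θ : UnitAddTorus d → ℝ} (hθ : Torus.IsSmooth θ) (hmaps : ∀ x, θ x ∈ U) :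
    Torus.IsSmooth (fun y => g (θ y)) :=
  hg.comp_contDiff hθ fun _ => hmaps _

/-- **Transport term**: for smooth divergence-free `v` and `g` smooth on an open set containing the
values of `|S|²`: `∫ g'(|S|²) ∑ᵢⱼ Sᵢⱼ ∑ₖ vₖ ∂ₖ(∂ᵢv)ⱼ = ½ ∫ (v·∇)(g ∘ |S|²) = 0`. [folklore] -/
theorem integral_deriv_comp_strainSqAt_mul_convect_eq_zero
    {v : UnitAddTorus d → EuclideanSpace ℝ d} (hv : Torus.IsSmooth v) (hdiv : Torus.IsDivFree v)
    {g : ℝ → ℝ} {U : Set ℝ} (hU : IsOpen U) (hg : ContDiffOn ℝ ∞ g U)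
    (hmaps : ∀ x, torusStrainSqAt v x ∈ U) :
    ∫ x, deriv g (torusStrainSqAt v x) * ∑ i, ∑ j,
      (Torus.partialDeriv j v x i + Torus.partialDeriv i v x j) / 2 *
        ∑ k, v x k * Torus.partialDeriv k (Torus.partialDeriv i v) x j = 0 := by
  have hQ : Torus.IsSmooth (torusStrainSqAt v) := isSmooth_strainSqAt hv
  have hθ : Torus.IsSmooth (fun y => g (torusStrainSqAt v y)) := isSmooth_comp hg hQ hmaps
  have hpt : ∀ x, deriv g (torusStrainSqAt v x) * ∑ i, ∑ j,
      (Torus.partialDeriv j v x i + Torus.partialDeriv i v x j) / 2 *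
        ∑ k, v x k * Torus.partialDeriv k (Torus.partialDeriv i v) x j =
      2⁻¹ * Torus.fderiv (fun y => g (torusStrainSqAt v y)) x (v x) := by
    intro x
    rw [Torus.fderiv_apply_eq_sum_partialDeriv (hθ.isContDiff (by simp))]
    have hgd : DifferentiableAt ℝ g (torusStrainSqAt v x) :=
      (hg.differentiableOn (by simp)).differentiableAt (hU.mem_nhds (hmaps x))
    have hk : ∀ k, Torus.partialDeriv k (fun y => g (torusStrainSqAt v y)) x =
        deriv g (torusStrainSqAt v x) * Torus.partialDeriv k (torusStrainSqAt v) x :=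
      fun k => Torus.partialDeriv_comp_of_contDiffOn hg hU hQ hmaps k x
    simp_rw [smul_eq_mul, hk, partialDeriv_strainSqAt hv]
    -- both sides are the same triple sum `∑ᵢⱼₖ G Eᵢⱼ vₖ ∂ₖ(∂ᵢv)ⱼ`
    have lhs : deriv g (torusStrainSqAt v x) * ∑ i, ∑ j,
        (Torus.partialDeriv j v x i + Torus.partialDeriv i v x j) / 2 *
          ∑ k, v x k * Torus.partialDeriv k (Torus.partialDeriv i v) x j =
        ∑ i, ∑ j, ∑ k, deriv g (torusStrainSqAt v x) *
          ((Torus.partialDeriv j v x i + Torus.partialDeriv i v x j) / 2) *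
            (v x k * Torus.partialDeriv k (Torus.partialDeriv i v) x j) := by
      simp only [Finset.mul_sum]
      exact Finset.sum_congr rfl fun i _ => Finset.sum_congr rfl fun j _ =>
        Finset.sum_congr rfl fun k _ => by ring
    have rhs : 2⁻¹ * ∑ k, v x k * (deriv g (torusStrainSqAt v x) *
        (2 * ∑ i, ∑ j, (Torus.partialDeriv j v x i + Torus.partialDeriv i v x j) / 2 *
          Torus.partialDeriv k (Torus.partialDeriv i v) x j)) =
        ∑ i, ∑ j, ∑ k, deriv g (torusStrainSqAt v x) *
          ((Torus.partialDeriv j v x i + Torus.partialDeriv i v x j) / 2) *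
            (v x k * Torus.partialDeriv k (Torus.partialDeriv i v) x j) := by
      simp only [Finset.mul_sum]
      rw [Finset.sum_comm]
      refine Finset.sum_congr rfl fun i _ => ?_
      rw [Finset.sum_comm]
      exact Finset.sum_congr rfl fun j _ => Finset.sum_congr rfl fun k _ => by ring
    rw [lhs, rhs]
  simp_rw [hpt, integral_const_mul, Torus.integral_fderiv_apply_eq_zero_of_isDivFree hv hθ hdiv,
    mul_zero]

/-- **The weighted strain balance along classical Navier–Stokes solutions on `T^d`.** Let `(u, p)`
be a classical solution of `∂ₜu + (u·∇)u = νΔu − ∇p + f`, `div u = 0` on `T^d × [a, b]` (`a < b`)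
and `Ψ` be `C^∞` on an open `U ⊆ ℝ` containing every `|S(u(s))(x)|²`, `s ∈ [a, b]`
(`|S|² = torusStrainSqAt`, `Sᵢⱼ = ((∂ⱼu)ᵢ + (∂ᵢu)ⱼ)/2`). Then `s ↦ ∫ Ψ(|S(s)|²)` has, at every
`t ∈ [a, b]`, the one-sided derivative
`2ν∫Ψ'(|S|²)∑ᵢⱼSᵢⱼ(∂ᵢΔu)ⱼ − 2∫Ψ'(|S|²)∑ᵢⱼSᵢⱼ∂ᵢ∂ⱼp + 2∫Ψ'(|S|²)∑ᵢⱼSᵢⱼ(∂ᵢf)ⱼ − 2∫Ψ'(|S|²)∑ᵢⱼSᵢⱼ∑ₖ(∂ᵢu)ₖ(∂ₖu)ⱼ`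
within `[a, b]` (the transport term vanishes since `div u = 0`; Majda–Bertozzi 2002 (1.29)/(1.30),
the symmetric part `D𝒟/Dt + 𝒟² + Ω² = −P + νΔ𝒟` contracted with `Ψ'(|𝒟|²)𝒟`).
[cite: MajdaBertozziCUP2002, §1.4 eq. (1.29)] -/
theorem hasDerivWithinAt_integral_comp_strainSqAt
    {a b ν : ℝ} {f u : ℝ → UnitAddTorus d → EuclideanSpace ℝ d} {p : ℝ → UnitAddTorus d → ℝ}
    (h : Torus.IsClassicalNSSolutionOn (Icc a b) ν f u p) (hab : a < b) {Ψ : ℝ → ℝ} {U : Set ℝ}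
    (hUo : IsOpen U) (hΨ : ContDiffOn ℝ ∞ Ψ U)
    (hmaps : ∀ s ∈ Icc a b, ∀ x, torusStrainSqAt (u s) x ∈ U) {t : ℝ} (ht : t ∈ Icc a b) :
    HasDerivWithinAt (fun s => ∫ x, Ψ (torusStrainSqAt (u s) x))
      (2 * ν * (∫ x, deriv Ψ (torusStrainSqAt (u t) x) * ∑ i, ∑ j,
          (Torus.partialDeriv j (u t) x i + Torus.partialDeriv i (u t) x j) / 2 *
            Torus.partialDeriv i (Torus.laplacian (u t)) x j) -
        2 * (∫ x, deriv Ψ (torusStrainSqAt (u t) x) * ∑ i, ∑ j,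
          (Torus.partialDeriv j (u t) x i + Torus.partialDeriv i (u t) x j) / 2 *
            Torus.partialDeriv i (Torus.partialDeriv j (p t)) x) +
        2 * (∫ x, deriv Ψ (torusStrainSqAt (u t) x) * ∑ i, ∑ j,
          (Torus.partialDeriv j (u t) x i + Torus.partialDeriv i (u t) x j) / 2 *
            Torus.partialDeriv i (f t) x j) -
        2 * ∫ x, deriv Ψ (torusStrainSqAt (u t) x) * ∑ i, ∑ j,
          (Torus.partialDeriv j (u t) x i + Torus.partialDeriv i (u t) x j) / 2 *
            ∑ k, Torus.partialDeriv i (u t) x k * Torus.partialDeriv k (u t) x j)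
      (Icc a b) t := by
  set S : Set ℝ := Icc a b with hSdef
  have hU : UniqueDiffOn ℝ S := uniqueDiffOn_Icc hab
  have hu : Torus.IsSmoothSpaceTimeOn S u := h.smooth_velocity
  have hut : Torus.IsSmooth (u t) := hu.isSmooth_slice ht
  have hdivt : Torus.IsDivFree (u t) := h.divFree t ht
  have hpt' : Torus.IsSmooth (p t) := h.smooth_pressure.isSmooth_slice ht
  have hQ : Torus.IsSmooth (torusStrainSqAt (u t)) := isSmooth_strainSqAt hut
  have hΨ1 : ContDiffOn ℝ ∞ (deriv Ψ) U := hΨ.deriv_of_isOpen hUo le_rfl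
  have hG1 : Torus.IsSmooth (fun y => deriv Ψ (torusStrainSqAt (u t) y)) :=
    isSmooth_comp hΨ1 hQ (hmaps t ht)
  have hA : Torus.IsSmooth (Torus.timeDerivWithin S u t) := hu.isSmooth_timeDerivWithin hU ht
  -- the forcing slice is smooth (momentum equation)
  have hf : Torus.IsSmooth (f t) := by
    have hfun : f t = fun y => Torus.timeDerivWithin S u t y + Torus.convect (u t) (u t) y -
        ν • Torus.laplacian (u t) y + Torus.gradient (p t) y := by
      funext y
      have := h.momentum t ht y
      rw [this]
      abel
    rw [hfun]
    exact ((hA.add (hut.convect hut)).sub (hut.laplacian.smul ν)).add hpt'.gradient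
  -- Step 1: differentiate under the integral sign
  have hQst : Torus.IsSmoothSpaceTimeOn S (fun s y => torusStrainSqAt (u s) y) :=
    isSmoothSpaceTimeOn_strainSqAt hu hU
  have hΦ : Torus.IsSmoothSpaceTimeOn S (fun s y => Ψ (torusStrainSqAt (u s) y)) :=
    hQst.comp_contDiffOn hΨ hmaps
  have hD := hΦ.hasDerivWithinAt_integral (convex_Icc a b) ht
  refine hD.congr_deriv ?_
  -- Step 2: chain rule in time, pointwise
  have hslice : ∀ x, Torus.timeDerivWithin S (fun s y => Ψ (torusStrainSqAt (u s) y)) t x =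
      deriv Ψ (torusStrainSqAt (u t) x) *
        Torus.timeDerivWithin S (fun s y => torusStrainSqAt (u s) y) t x := by
    intro x
    have h1 := hQst.hasDerivWithinAt_slice ht x
    have hΨd : HasDerivAt Ψ (deriv Ψ (torusStrainSqAt (u t) x)) (torusStrainSqAt (u t) x) :=
      ((hΨ.differentiableOn (by simp)).differentiableAt (hUo.mem_nhds (hmaps t ht x))).hasDerivAt
    have hc := hΨd.comp_hasDerivWithinAt t h1
    rw [Torus.timeDerivWithin]
    exact hc.derivWithin (hU t ht)
  have hQt : ∀ x, Torus.timeDerivWithin S (fun s y => torusStrainSqAt (u s) y) t x = _ :=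
    fun x => timeDerivWithin_strainSqAt h hab ht x
  simp_rw [hslice, hQt]
  -- Step 3: names for the densities and the split of the integral
  set G : UnitAddTorus d → ℝ := fun y => deriv Ψ (torusStrainSqAt (u t) y) with hGdef
  set E : d → d → UnitAddTorus d → ℝ := fun i j y =>
    (Torus.partialDeriv j (u t) y i + Torus.partialDeriv i (u t) y j) / 2 with hEdef
  obtain ⟨T1, hT1⟩ : ∃ T : UnitAddTorus d → ℝ, T = fun y => ∑ i, ∑ j, E i j y *
    Torus.partialDeriv i (Torus.laplacian (u t)) y j := ⟨_, rfl⟩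
  obtain ⟨T2, hT2⟩ : ∃ T : UnitAddTorus d → ℝ, T = fun y => ∑ i, ∑ j, E i j y *
    Torus.partialDeriv i (Torus.partialDeriv j (p t)) y := ⟨_, rfl⟩
  obtain ⟨T3, hT3⟩ : ∃ T : UnitAddTorus d → ℝ, T = fun y => ∑ i, ∑ j, E i j y *
    Torus.partialDeriv i (f t) y j := ⟨_, rfl⟩
  obtain ⟨T4, hT4⟩ : ∃ T : UnitAddTorus d → ℝ, T = fun y => ∑ i, ∑ j, E i j y *
    ∑ k, Torus.partialDeriv i (u t) y k * Torus.partialDeriv k (u t) y j := ⟨_, rfl⟩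
  obtain ⟨T5, hT5⟩ : ∃ T : UnitAddTorus d → ℝ, T = fun y => ∑ i, ∑ j, E i j y *
    ∑ k, u t y k * Torus.partialDeriv k (Torus.partialDeriv i (u t)) y j := ⟨_, rfl⟩
  have hEs : ∀ i j, Torus.IsSmooth (E i j) := fun i j => isSmooth_strainEntry hut i j
  have hs2 : ∀ {g : d → d → UnitAddTorus d → ℝ}, (∀ i j, Torus.IsSmooth (g i j)) →
      Torus.IsSmooth (fun y => ∑ i, ∑ j, g i j y) := fun hg =>
    ContDiff.sum fun i _ => ContDiff.sum fun j _ => hg i j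
  have hT1s : Torus.IsSmooth T1 := by
    rw [hT1]; exact hs2 fun i j => (hEs i j).mul ((hut.laplacian.partialDeriv i).apply j)
  have hT2s : Torus.IsSmooth T2 := by
    rw [hT2]; exact hs2 fun i j => (hEs i j).mul ((hpt'.partialDeriv j).partialDeriv i)
  have hT3s : Torus.IsSmooth T3 := by
    rw [hT3]; exact hs2 fun i j => (hEs i j).mul ((hf.partialDeriv i).apply j)
  have hT4s : Torus.IsSmooth T4 := by
    rw [hT4]; exact hs2 fun i j => (hEs i j).mul
      (ContDiff.sum fun k _ => ((hut.partialDeriv i).apply k).mul ((hut.partialDeriv k).apply j))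
  have hT5s : Torus.IsSmooth T5 := by
    rw [hT5]; exact hs2 fun i j => (hEs i j).mul
      (ContDiff.sum fun k _ => (hut.apply k).mul (((hut.partialDeriv i).partialDeriv k).apply j))
  have e1 : ∀ x, G x * (2 * ∑ i, ∑ j, E i j x *
      (ν * Torus.partialDeriv i (Torus.laplacian (u t)) x j -
        Torus.partialDeriv i (Torus.partialDeriv j (p t)) x + Torus.partialDeriv i (f t) x j -
        (∑ k, Torus.partialDeriv i (u t) x k * Torus.partialDeriv k (u t) x j) -
        ∑ k, u t x k * Torus.partialDeriv k (Torus.partialDeriv i (u t)) x j)) =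
      2 * ν * (G x * T1 x) - 2 * (G x * T2 x) + 2 * (G x * T3 x) - 2 * (G x * T4 x) -
        2 * (G x * T5 x) := by
    intro x
    rw [hT1, hT2, hT3, hT4, hT5]
    simp only [mul_sub, mul_add, Finset.sum_sub_distrib, Finset.sum_add_distrib, Finset.mul_sum]
    refine congrArg₂ (· - ·) (congrArg₂ (· - ·) (congrArg₂ (· + ·) (congrArg₂ (· - ·) ?_ ?_) ?_) ?_) ?_
    all_goals
      refine Finset.sum_congr rfl fun i _ => Finset.sum_congr rfl fun j _ => ?_
      ring
  have iT : ∀ {T : UnitAddTorus d → ℝ}, Torus.IsSmooth T → ∀ c : ℝ,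
      Integrable (fun x => c * (G x * T x)) := fun hT c =>
    ((hG1.continuous.mul hT.continuous).integrable_unitAddTorus).const_mul c
  have i1 := iT hT1s (2 * ν)
  have i2 := iT hT2s 2
  have i3 := iT hT3s 2
  have i4 := iT hT4s 2
  have i5 := iT hT5s 2
  have hsplit : ∫ x, G x * (2 * ∑ i, ∑ j, E i j x *
      (ν * Torus.partialDeriv i (Torus.laplacian (u t)) x j -
        Torus.partialDeriv i (Torus.partialDeriv j (p t)) x + Torus.partialDeriv i (f t) x j -
        (∑ k, Torus.partialDeriv i (u t) x k * Torus.partialDeriv k (u t) x j) -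
        ∑ k, u t x k * Torus.partialDeriv k (Torus.partialDeriv i (u t)) x j)) =
      2 * ν * (∫ x, G x * T1 x) - 2 * (∫ x, G x * T2 x) + 2 * (∫ x, G x * T3 x) -
        2 * (∫ x, G x * T4 x) - 2 * ∫ x, G x * T5 x := by
    simp_rw [e1]
    have i12 : Integrable (fun x => 2 * ν * (G x * T1 x) - 2 * (G x * T2 x)) := i1.sub i2
    have i123 : Integrable (fun x => 2 * ν * (G x * T1 x) - 2 * (G x * T2 x) + 2 * (G x * T3 x)) :=
      i12.add i3
    have i1234 : Integrable (fun x => 2 * ν * (G x * T1 x) - 2 * (G x * T2 x) + 2 * (G x * T3 x) -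
        2 * (G x * T4 x)) := i123.sub i4
    rw [integral_sub i1234 i5, integral_sub i123 i4, integral_add i12 i3, integral_sub i1 i2,
      integral_const_mul, integral_const_mul, integral_const_mul, integral_const_mul,
      integral_const_mul]
  -- Step 4: the transport term vanishes
  have htrans : ∫ x, G x * T5 x = 0 := by
    rw [hT5]
    exact integral_deriv_comp_strainSqAt_mul_convect_eq_zero hut hdivt hUo hΨ (hmaps t ht)
  change ∫ x, G x * (2 * ∑ i, ∑ j, E i j x * _) = _
  rw [hsplit, htrans, mul_zero, sub_zero, hT1, hT2, hT3, hT4]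

end GradientTensor

end Summit.NavierStokesRegularity.FunctionalMining
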